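import Literature.Topology.FourManifolds.LevelTranslation
import Literature.Topology.FourManifolds.Isotopy
import HarnessLib

/-!
# Restricting an ambient isotopy to an invariant submanifold presented by an embedding

Topic `Literature/Topology/FourManifolds`.  In the proof of Thm. 5.4, Assertion 6 (Milnor,
*Lectures on the h-cobordism theorem* (1965), PDF pp. 31–32) the deformation of the level
diffeomorphism `h : f⁻¹(b₁) → f⁻¹(b₂)` is an isotopy of the level `f⁻¹(b₂)`; the tree presents
levels by closed manifolds `V` smoothly embedded onto them (`ι : V → W`, `range ι = f⁻¹(b₂)`,
`RegularLevelSet.lean`), and the isotopy is produced inside the cobordism `W` as an ambient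
isotopy preserving `f`.  This file restricts such an ambient isotopy of `W` to `V`:

* `AmbientIsotopy.restrict` — for an ambient isotopy `F` of `W` whose stages and inverse stages
  map `range ι` into itself, the lifted stages `v ↦ ι⁻¹(F_t(ι v))`
  (`Literature.Topology.FourManifolds.liftOfRange`) form an ambient isotopy of `V` (smooth by
  `Literature.Topology.FourManifolds.contMDiff_liftOfRange`: a map into the source of a smooth
  embedding is smooth when its composite with the embedding is);
* `AmbientIsotopy.apply_restrict` — `ι (F|_t v) = F_t (ι v)`;
* `AmbientIsotopy.restrictOfPreserves` — the case of the level set `{f = a}` of a function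
  preserved by every stage (`f ∘ F_t = f`).

Everything is proved; no named facts.

## References

* M. W. Hirsch, *Differential Topology*, GTM 33 (1976), Ch. 8 §1, p. 178. [HirschDT1976]
* J. Milnor, *Lectures on the h-cobordism theorem* (1965), proof of Thm. 5.4, Assertion 6
  (PDF pp. 31–32). [MilnorHCobordism1965]
-/

open scoped Manifold ContDiff Topology
open Set Function Filter

noncomputable section

namespace Literature.Topology.FourManifolds

namespace AmbientIsotopy

universe u

variable {EV : Type*} [NormedAddCommGroup EV] [NormedSpace ℝ EV] {HV : Type*} [TopologicalSpace HV]
  {IV : ModelWithCorners ℝ EV HV} {V : Type*} [TopologicalSpace V] [ChartedSpace HV V]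
  {EW : Type u} [NormedAddCommGroup EW] [NormedSpace ℝ EW] {HW : Type*} [TopologicalSpace HW]
  {IW : ModelWithCorners ℝ EW HW} {W : Type*} [TopologicalSpace W] [ChartedSpace HW W]

/-- The inverse stage of an ambient isotopy, as a function. [folklore] -/
abbrev invStage (F : AmbientIsotopy IW W) (t : ℝ) : W → W := (F.toDiffeomorph t).symm

/-- `F_t⁻¹ (F_t x) = x`. [folklore] -/
@[simp] theorem invStage_toFun (F : AmbientIsotopy IW W) (t : ℝ) (x : W) :
    F.invStage t (F.toFun t x) = x :=
  (F.toDiffeomorph t).symm_apply_apply x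

/-- `F_t (F_t⁻¹ y) = y`. [folklore] -/
@[simp] theorem toFun_invStage (F : AmbientIsotopy IW W) (t : ℝ) (y : W) :
    F.toFun t (F.invStage t y) = y :=
  (F.toDiffeomorph t).apply_symm_apply y

/-- The inverse stage is smooth. [folklore] -/
theorem contMDiff_invStage (F : AmbientIsotopy IW W) (t : ℝ) : ContMDiff IW IW ∞ (F.invStage t) :=
  (F.toDiffeomorph t).symm.contMDiff

section Restrict

variable (F : AmbientIsotopy IW W) {ι : V → W} (hι : Manifold.IsSmoothEmbedding IV IW ∞ ι)
  (hF : ∀ t v, F.toFun t (ι v) ∈ range ι) (hF' : ∀ t v, F.invStage t (ι v) ∈ range ι)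

/-- The restricted stage `v ↦ ι⁻¹(F_t(ι v))`. [folklore] -/
def restrictFun (t : ℝ) : V → V :=
  liftOfRange ι hι.isEmbedding.injective (fun v => F.toFun t (ι v)) (hF t)

/-- The restricted inverse stage `v ↦ ι⁻¹(F_t⁻¹(ι v))`. [folklore] -/
def restrictInv (t : ℝ) : V → V :=
  liftOfRange ι hι.isEmbedding.injective (fun v => F.invStage t (ι v)) (hF' t)

/-- `ι (F|_t v) = F_t (ι v)`. [folklore] -/
theorem apply_restrictFun (t : ℝ) (v : V) : ι (F.restrictFun hι hF t v) = F.toFun t (ι v) :=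
  apply_liftOfRange ι hι.isEmbedding.injective _ (hF t) v

/-- `ι (F|_t⁻¹ v) = F_t⁻¹ (ι v)`. [folklore] -/
theorem apply_restrictInv (t : ℝ) (v : V) : ι (F.restrictInv hι hF' t v) = F.invStage t (ι v) :=
  apply_liftOfRange ι hι.isEmbedding.injective _ (hF' t) v

/-- The restricted inverse stage undoes the restricted stage. [folklore] -/
theorem restrictInv_restrictFun (t : ℝ) (v : V) :
    F.restrictInv hι hF' t (F.restrictFun hι hF t v) = v := by
  apply hι.isEmbedding.injective
  rw [F.apply_restrictInv hι hF' t, F.apply_restrictFun hι hF t, invStage_toFun]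

/-- The restricted stage undoes the restricted inverse stage. [folklore] -/
theorem restrictFun_restrictInv (t : ℝ) (v : V) :
    F.restrictFun hι hF t (F.restrictInv hι hF' t v) = v := by
  apply hι.isEmbedding.injective
  rw [F.apply_restrictFun hι hF t, F.apply_restrictInv hι hF' t, toFun_invStage]

/-- The restricted stages are jointly smooth. [folklore] -/
theorem contMDiff_uncurry_restrictFun :
    ContMDiff (𝓘(ℝ, ℝ).prod IV) IV ∞ (uncurry (F.restrictFun hι hF)) := by
  have h : ContMDiff (𝓘(ℝ, ℝ).prod IV) IW ∞ fun p : ℝ × V => F.toFun p.1 (ι p.2) :=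
    F.contMDiff.comp (contMDiff_fst.prodMk (hι.contMDiff.comp contMDiff_snd))
  exact contMDiff_liftOfRange (X := ℝ × V) hι (g := fun p : ℝ × V => F.toFun p.1 (ι p.2))
    (fun p => hF p.1 p.2) h

/-- Each restricted stage is smooth. [folklore] -/
theorem contMDiff_restrictFun (t : ℝ) : ContMDiff IV IV ∞ (F.restrictFun hι hF t) :=
  contMDiff_liftOfRange hι (hF t) ((F.contMDiff_toFun t).comp hι.contMDiff)

/-- Each restricted inverse stage is smooth. [folklore] -/
theorem contMDiff_restrictInv (t : ℝ) : ContMDiff IV IV ∞ (F.restrictInv hι hF' t) :=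
  contMDiff_liftOfRange hι (hF' t) ((F.contMDiff_invStage t).comp hι.contMDiff)

/-- **The restricted stage as a diffeomorphism of `V`.** [folklore] -/
def restrictStage (t : ℝ) : V ≃ₘ⟮IV, IV⟯ V where
  toFun := F.restrictFun hι hF t
  invFun := F.restrictInv hι hF' t
  left_inv := F.restrictInv_restrictFun hι hF hF' t
  right_inv := F.restrictFun_restrictInv hι hF hF' t
  contMDiff_toFun := F.contMDiff_restrictFun hι hF t
  contMDiff_invFun := F.contMDiff_restrictInv hι hF' t

/-- **Restriction of an ambient isotopy to an invariant submanifold presented by a smooth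
embedding `ι : V → W`**: if every stage and every inverse stage of `F` maps `range ι` into
itself, the lifted stages `v ↦ ι⁻¹(F_t(ι v))` form an ambient isotopy of `V`.
[cite: HirschDT1976, Ch. 8 §1, p. 178] -/
def restrict : AmbientIsotopy IV V where
  toFun := F.restrictFun hι hF
  contMDiff := F.contMDiff_uncurry_restrictFun hι hF
  bijective t := (F.restrictStage hι hF hF' t).bijective
  isLocalDiffeomorph t := (F.restrictStage hι hF hF' t).isLocalDiffeomorph
  map_zero := by
    funext v
    apply hι.isEmbedding.injective
    rw [F.apply_restrictFun hι hF 0 v, F.map_zero]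
    rfl

/-- Stages of the restriction (definitional). [folklore] -/
@[simp] theorem restrict_toFun (t : ℝ) : (F.restrict hι hF hF').toFun t = F.restrictFun hι hF t := rfl

/-- `ι ((F.restrict …)_t v) = F_t (ι v)`. [folklore] -/
theorem apply_restrict (t : ℝ) (v : V) : ι ((F.restrict hι hF hF').toFun t v) = F.toFun t (ι v) :=
  F.apply_restrictFun hι hF t v

/-- Images under the restriction: `ι '' ((F.restrict …)_t '' A) = F_t '' (ι '' A)`. [folklore] -/
theorem image_image_restrict (t : ℝ) (A : Set V) :
    ι '' ((F.restrict hι hF hF').toFun t '' A) = F.toFun t '' (ι '' A) := by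
  rw [image_image, image_image]
  exact image_congr fun v _ => F.apply_restrict hι hF hF' t v

end Restrict

section Preserves

variable (F : AmbientIsotopy IW W) {ι : V → W} (hι : Manifold.IsSmoothEmbedding IV IW ∞ ι)
  {f : W → ℝ} {a : ℝ} (hrange : range ι = f ⁻¹' {a}) (hf : ∀ t x, f (F.toFun t x) = f x)

omit [TopologicalSpace V] [ChartedSpace HV V] in
include hrange hf in
/-- If every stage preserves `f`, the stages map the level `range ι = {f = a}` into itself. [folklore] -/
theorem toFun_mem_range_of_preserves (t : ℝ) (v : V) : F.toFun t (ι v) ∈ range ι := by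
  rw [hrange, mem_preimage, mem_singleton_iff, hf]
  have : ι v ∈ range ι := mem_range_self v
  rw [hrange] at this
  exact this

omit [TopologicalSpace V] [ChartedSpace HV V] in
include hrange hf in
/-- If every stage preserves `f`, the inverse stages map the level into itself. [folklore] -/
theorem invStage_mem_range_of_preserves (t : ℝ) (v : V) : F.invStage t (ι v) ∈ range ι := by
  rw [hrange, mem_preimage, mem_singleton_iff]
  have h1 : f (F.toFun t (F.invStage t (ι v))) = f (F.invStage t (ι v)) := hf t _
  rw [toFun_invStage] at h1
  have : ι v ∈ range ι := mem_range_self v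
  rw [hrange] at this
  rw [← h1]
  exact this

/-- **Restriction of an `f`-preserving ambient isotopy of `W` to a level `{f = a}` presented by
a smooth embedding `ι : V → W` with `range ι = f⁻¹(a)`.** [cite: HirschDT1976, Ch. 8 §1, p. 178] -/
def restrictOfPreserves : AmbientIsotopy IV V :=
  F.restrict hι (F.toFun_mem_range_of_preserves hrange hf) (F.invStage_mem_range_of_preserves hrange hf)

/-- `ι ((F.restrictOfPreserves …)_t v) = F_t (ι v)`. [folklore] -/
theorem apply_restrictOfPreserves (t : ℝ) (v : V) :
    ι ((F.restrictOfPreserves hι hrange hf).toFun t v) = F.toFun t (ι v) :=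
  F.apply_restrict hι _ _ t v

/-- Images under the restriction to a level. [folklore] -/
theorem image_image_restrictOfPreserves (t : ℝ) (A : Set V) :
    ι '' ((F.restrictOfPreserves hι hrange hf).toFun t '' A) = F.toFun t '' (ι '' A) :=
  F.image_image_restrict hι _ _ t A

end Preserves

end AmbientIsotopy

end Literature.Topology.FourManifolds
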